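import Summits.MatrixMultiplication.MatrixMultiplication.Theorems.FarEdgeDescentConverseRigidity
import Summits.MatrixMultiplication.MatrixMultiplication.Theorems.OutsiderSandwichBlockNormalForm
import Literature.Computability.AlgebraicComplexity.GroupAlgebraTensor
import Literature.Computability.AlgebraicComplexity.LaserMethodValuesSym
import HarnessLib

/-!
# The rotation bridge: lens-4's coupled block `C₁` IS the twisted star `𝔖₂(1)`, hence
# `{C₁^{⊠N}, ⟨2,2,2⟩^{⊠N}}` is a degeneration antichain for every `N ≥ 1`

Route `FarEdgeDescent` (decomposition cell `decomp-mm`, lens 2 «structural dichotomy», gen 29),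
support for the aside `SubLogRate` (stmt-MatrixMultiplication-25371); written for the sister lens 4
(`Theses/OutsiderSandwich.lean`, items `BlockOneIsMM` 27147 / 27150) and the cell census (rows I52,
I64 «one tensor, three lenses»), which had the statements below "modulo a rotation bridge".

The coupled block `C₁ = T^{[211]}` of `cw₂ ⊗ cw₂` (`coupling₁`, Coppersmith–Winograd 1990 §7) is, by
`coupling₁_eq_pairTensor` (lens 4), the tensor `pairTensor 2` of `(A; u, w) ↦ (Au, Aᵀw)` with legs
ordered `(A, inputs, outputs)`.  The twisted star `𝔖_n(1) = twistedStar ℂ n 1` of this lineage is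
the same bilinear map with legs ordered `(outputs, A, inputs)` (the tree's `matMulTensor` order).
We record the dictionary as mutual RESTRICTIONS along explicit leg encoders
(`pairTensor n ≅ rotate (twistedStar ℂ n 1)`, `coupling₁ ≅ rotate (twistedStar ℂ 2 1)`), and
transport the two finite-level rigidity theorems of the lineage — Kernel II
(`twistedStar_pow_not_algDegeneratesTo`, alternating self-pairing) and Kernel IV
(`matMul_pow_not_algDegeneratesTo_twistedStar_pow`, slice commutant) — along the relabelling of
the three modes (`algDegeneratesTo_of_rotate`, Bläser 2013, Thm. 6.3) and the cyclic symmetry of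
`⟨2,2,2⟩` (`tensorRestrictsTo_rotate_matMulTensor`, Bläser 2013, Lemma 5.5):

* `coupling₁_pow_not_algDegeneratesTo_matMul_pow` — `⟨2,2,2⟩^{⊠N}` is NOT a degeneration of
  `C₁^{⊠N}` (`N ≥ 1`): one copy of the coupled block never pays for one matrix product, in any power
  (the census exchange-rate floor `r_deg(N) ≥ 2`, previously by a Kempf–Ness argument over `ℂ`);
* `matMul_pow_not_algDegeneratesTo_coupling₁_pow` — `C₁^{⊠N}` is NOT a degeneration of
  `⟨2,2,2⟩^{⊠N}` (`N ≥ 1`);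
* `coupling₁_pow_incomparable` — both, and the general-`n` versions for `pairTensor n` against the
  coherent pair map `rotate ⟨n,n,2⟩` (`pairTensor_pow_incomparable`, `n ≥ 2`).

No `sorry`, no new definitions (the leg encoders are written inline).

## References

* D. Coppersmith, S. Winograd, *Matrix multiplication via arithmetic progressions*, J. Symb. Comp. 9
  (1990), §7. [CoppersmithWinograd1990]
* M. Bläser, *Fast Matrix Multiplication*, Theory of Computing Graduate Surveys 5 (2013), Lemma 5.5,
  Thm. 6.3. [Blaser2013]
* P. Bürgisser, M. Clausen, M. A. Shokrollahi, *Algebraic Complexity Theory* (1997), (15.19)–(15.25).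
  [BurgisserClausenShokrollahi1997]
-/

noncomputable section

open scoped BigOperators Polynomial

set_option linter.dupNamespace false
namespace Summit.MatrixMultiplication.MatrixMultiplication.Theorems.FarEdgeDescentCouplingBridge

open Literature.Computability.AlgebraicComplexity
  Summit.MatrixMultiplication.MatrixMultiplication.Theorems.FarEdgeDescentTwistedStar
  Summit.MatrixMultiplication.MatrixMultiplication.Theorems.FarEdgeDescentPairingObstruction
  Summit.MatrixMultiplication.MatrixMultiplication.Theorems.FarEdgeDescentConverseRigidity
  Summit.MatrixMultiplication.MatrixMultiplication.Theorems.OutsiderSandwichCoupling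
  Summit.MatrixMultiplication.MatrixMultiplication.Theorems.OutsiderSandwichBlockNormalForm

/-! ## 1. The dictionary between `pairTensor n` and `𝔖_n(1)`

Leg encoders (written inline, no new definitions): an input index `(half, pos)` of `pairTensor n`
goes to the leaf variable `inl (pos, 0)` (`u`, indexed by the COLUMN of `A`, leaf `Y`) if
`half = 0` and to `inr (pos, 0)` (`w`, indexed by the row, leaf `Y'`) if `half = 1`; an output index
goes to `inl (pos, 0)` (`Au`, leaf `Z = XY`) if `half = 1` and to `inr (pos, 0)` (`Aᵀw`, leaf
`Z' = XᵀY'`) if `half = 0`.  The decoders are the evident inverses (`Fin 1` is a point). -/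

/-- **The dictionary, encoded**: `pairTensor n (A; y; z) = 𝔖_n(1) (encode z; A; encode y)`.
[cite: CoppersmithWinograd1990, §7] -/
theorem pairTensor_eq_twistedStar (n : ℕ) (a : Fin n × Fin n) (y z : Fin 2 × Fin n) :
    pairTensor n a y z =
      twistedStar ℂ n 1 (if z.1 = 0 then Sum.inr (z.2, 0) else Sum.inl (z.2, 0)) a
        (if y.1 = 0 then Sum.inl (y.2, 0) else Sum.inr (y.2, 0)) := by
  obtain ⟨a₁, a₂⟩ := a
  obtain ⟨y₁, y₂⟩ := y
  obtain ⟨z₁, z₂⟩ := z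
  simp only [pairTensor]
  fin_cases y₁ <;> fin_cases z₁ <;>
    simp [twistedStar, matMulTensor, eq_comm, and_comm]

/-- **The dictionary, decoded**: `𝔖_n(1) (zz; A; yy) = pairTensor n (A; decode yy; decode zz)`.
[cite: CoppersmithWinograd1990, §7] -/
theorem twistedStar_eq_pairTensor (n : ℕ) (zz : (Fin n × Fin 1) ⊕ (Fin n × Fin 1))
    (a : Fin n × Fin n) (yy : (Fin n × Fin 1) ⊕ (Fin n × Fin 1)) :
    twistedStar ℂ n 1 zz a yy =
      pairTensor n a (Sum.elim (fun p => (0, p.1)) (fun p => (1, p.1)) yy)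
        (Sum.elim (fun p => (1, p.1)) (fun p => (0, p.1)) zz) := by
  obtain ⟨a₁, a₂⟩ := a
  rcases zz with ⟨κ, c⟩ | ⟨κ, c⟩ <;> rcases yy with ⟨μ, d⟩ | ⟨μ, d⟩ <;>
    obtain rfl : c = 0 := Fin.fin_one_eq_zero c <;> obtain rfl : d = 0 := Fin.fin_one_eq_zero d <;>
    simp [twistedStar, matMulTensor, pairTensor, eq_comm, and_comm]

/-! ## 2. Mutual restrictions (the tensors are isomorphic up to one rotation of the legs) -/

/-- `rotate 𝔖_n(1) ≥ pairTensor n` (relabelling along the encoders). [cite: Blaser2013, Lemma 5.5] -/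
theorem rotate_twistedStar_restrictsTo_pairTensor (n : ℕ) :
    TensorRestrictsTo (rotate (twistedStar ℂ n 1)) (pairTensor n) := by
  have e : pairTensor n = fun a y z => rotate (twistedStar ℂ n 1) a
      (if y.1 = 0 then Sum.inl (y.2, 0) else Sum.inr (y.2, 0))
      (if z.1 = 0 then Sum.inr (z.2, 0) else Sum.inl (z.2, 0)) := by
    funext a y z
    rw [rotate_apply]
    exact pairTensor_eq_twistedStar n a y z
  rw [e]
  exact tensorRestrictsTo_precomp _ _ _ _

/-- `pairTensor n ≥ rotate 𝔖_n(1)` (relabelling along the decoders). [cite: Blaser2013, Lemma 5.5] -/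
theorem pairTensor_restrictsTo_rotate_twistedStar (n : ℕ) :
    TensorRestrictsTo (pairTensor n) (rotate (twistedStar ℂ n 1)) := by
  have e : rotate (twistedStar ℂ n 1) = fun a yy zz => pairTensor n a
      (Sum.elim (fun p => (0, p.1)) (fun p => (1, p.1)) yy)
      (Sum.elim (fun p => (1, p.1)) (fun p => (0, p.1)) zz) := by
    funext a yy zz
    rw [rotate_apply]
    exact twistedStar_eq_pairTensor n zz a yy
  rw [e]
  exact tensorRestrictsTo_precomp _ _ _ _

/-- `C₁ ≥ rotate 𝔖₂(1)`: the coupled block of `cw₂ ⊗ cw₂` restricts to (indeed is isomorphic to)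
the twisted star `𝔖₂(1)` with legs rotated once. [cite: CoppersmithWinograd1990, §7] -/
theorem coupling₁_restrictsTo_rotate_twistedStar :
    TensorRestrictsTo coupling₁ (rotate (twistedStar ℂ 2 1)) :=
  coupling₁_restrictsTo_pairTensor.trans (pairTensor_restrictsTo_rotate_twistedStar 2)

/-- `rotate 𝔖₂(1) ≥ C₁`. [cite: CoppersmithWinograd1990, §7] -/
theorem rotate_twistedStar_restrictsTo_coupling₁ :
    TensorRestrictsTo (rotate (twistedStar ℂ 2 1)) coupling₁ :=
  (rotate_twistedStar_restrictsTo_pairTensor 2).trans pairTensor_restrictsTo_coupling₁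

/-- Hence every universal spectral point takes the same value on `C₁` and on `rotate 𝔖₂(1)`.
[cite: Strassen1988, Thm. 2.3] -/
theorem map_coupling₁_eq_map_rotate_twistedStar {F : SpectralMap ℂ}
    (hF : IsUniversalSpectralPoint ℂ F) : F coupling₁ = F (rotate (twistedStar ℂ 2 1)) :=
  le_antisymm (hF.mono _ _ rotate_twistedStar_restrictsTo_coupling₁)
    (hF.mono _ _ coupling₁_restrictsTo_rotate_twistedStar)

/-! ## 3. Un-rotating a degeneration; the cyclic symmetry of `⟨2,2,2⟩` -/

/-- **Un-rotating the three modes of a degeneration**: if `πt ⊴ πs` for the cyclic permutation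
`π` of the factors, then `t ⊴ s` (permute the three border matrices back; Bläser 2013, Thm. 6.3 —
the tree's `algDegeneratesTo_rotate_modes` is the forward direction). [cite: Blaser2013, Thm. 6.3] -/
theorem algDegeneratesTo_of_rotate {K : Type*} [Field K] {ι κ μ ι' κ' μ' : Type*} [Fintype ι]
    [Fintype κ] [Fintype μ] {s : ι → κ → μ → K} {t : ι' → κ' → μ' → K}
    (hd : AlgDegeneratesTo (rotate s) (rotate t)) : AlgDegeneratesTo s t := by
  obtain ⟨h, B, C, A, hr⟩ := hd
  refine ⟨h, A, B, C, ?_⟩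
  intro a' b' c' j hj
  have e₁ : ∀ a b c, A a' a * B b' b * C c' c * Polynomial.C (s a b c) =
      B b' b * C c' c * A a' a * Polynomial.C (rotate s b c a) := fun a b c => by
    rw [rotate_apply]; ring
  simp only [e₁]
  rw [Finset.sum_comm, Finset.sum_congr rfl fun b _ => Finset.sum_comm,
    show t a' b' c' = rotate t b' c' a' from rfl]
  exact hr b' c' a' j hj

/-- `⟨2,2,2⟩ ≥ rotate ⟨2,2,2⟩` (cyclic symmetry of the square matrix product: `rotate ⟨k,m,n⟩` is
`⟨m,n,k⟩` with swapped coordinates, tree `matMulTensor_rotate`). [cite: Blaser2013, Lemma 5.5] -/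
theorem matMul_restrictsTo_rotate_matMul :
    TensorRestrictsTo (matMulTensor ℂ 2 2 2) (rotate (matMulTensor ℂ 2 2 2)) := by
  have e : rotate (matMulTensor ℂ 2 2 2) = fun b c a => matMulTensor ℂ 2 2 2 b.swap c a.swap := by
    funext b c a
    rw [rotate_apply]
    exact matMulTensor_rotate ℂ 2 2 2 b c a
  rw [e]
  exact tensorRestrictsTo_precomp _ _ _ _

/-! ## 4. Transport of Kernels II and IV -/

/-- **`rotate ⟨n,n,2⟩^{⊠N}` is not a degeneration of `(pairTensor n)^{⊠N}`** (`n ≥ 2`, `N ≥ 1`):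
Kernel II transported — `N` copies of `(A; u, w) ↦ (Au, Aᵀw)` never degenerate to `N` copies of
`(A; u, u') ↦ (Au, Au')`. [cite: Blaser2013, Thm. 6.3] -/
theorem pairTensor_pow_not_algDegeneratesTo_rotate_matMul_pow (n N : ℕ) (hn : 2 ≤ n) (hN : 1 ≤ N) :
    ¬ AlgDegeneratesTo (kroneckerPow (pairTensor n) N)
      (kroneckerPow (rotate (matMulTensor ℂ n n 2)) N) := by
  intro h
  have h₁ : AlgDegeneratesTo (kroneckerPow (rotate (twistedStar ℂ n 1)) N)
      (kroneckerPow (rotate (matMulTensor ℂ n n 2)) N) :=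
    ((rotate_twistedStar_restrictsTo_pairTensor n).kroneckerPow N).algDegeneratesTo_trans h
  exact twistedStar_pow_not_algDegeneratesTo n 1 N le_rfl hn hN (algDegeneratesTo_of_rotate h₁)

/-- **`(pairTensor n)^{⊠N}` is not a degeneration of `rotate ⟨n,n,2⟩^{⊠N}`** (`n ≥ 2`, `N ≥ 1`):
Kernel IV transported. [cite: Blaser2013, Thm. 6.3] -/
theorem rotate_matMul_pow_not_algDegeneratesTo_pairTensor_pow (n N : ℕ) (hn : 2 ≤ n) (hN : 1 ≤ N) :
    ¬ AlgDegeneratesTo (kroneckerPow (rotate (matMulTensor ℂ n n 2)) N)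
      (kroneckerPow (pairTensor n) N) := by
  intro h
  have h₁ : AlgDegeneratesTo (kroneckerPow (rotate (matMulTensor ℂ n n 2)) N)
      (kroneckerPow (rotate (twistedStar ℂ n 1)) N) :=
    h.trans_restrictsTo ((pairTensor_restrictsTo_rotate_twistedStar n).kroneckerPow N)
  exact matMul_pow_not_algDegeneratesTo_twistedStar_pow n 1 N hn le_rfl hN (algDegeneratesTo_of_rotate h₁)

/-- **Degeneration-incomparability of `pairTensor n` and the coherent pair map at every finite
level** (`n ≥ 2`, `N ≥ 1`). [cite: Blaser2013, Thm. 6.3] -/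
theorem pairTensor_pow_incomparable (n N : ℕ) (hn : 2 ≤ n) (hN : 1 ≤ N) :
    ¬ AlgDegeneratesTo (kroneckerPow (pairTensor n) N)
        (kroneckerPow (rotate (matMulTensor ℂ n n 2)) N) ∧
      ¬ AlgDegeneratesTo (kroneckerPow (rotate (matMulTensor ℂ n n 2)) N)
        (kroneckerPow (pairTensor n) N) :=
  ⟨pairTensor_pow_not_algDegeneratesTo_rotate_matMul_pow n N hn hN,
    rotate_matMul_pow_not_algDegeneratesTo_pairTensor_pow n N hn hN⟩

/-- **`⟨2,2,2⟩^{⊠N}` is not a degeneration of `C₁^{⊠N}`** (`N ≥ 1`; census floor `r_deg(N) ≥ 2`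
made kernel-grade): Kernel II through the bridge and the cyclic symmetry `⟨2,2,2⟩ ≥ rotate ⟨2,2,2⟩`.
[cite: Blaser2013, Lemma 5.5, Thm. 6.3] -/
theorem coupling₁_pow_not_algDegeneratesTo_matMul_pow (N : ℕ) (hN : 1 ≤ N) :
    ¬ AlgDegeneratesTo (kroneckerPow coupling₁ N) (kroneckerPow (matMulTensor ℂ 2 2 2) N) := by
  intro h
  have h₁ : AlgDegeneratesTo (kroneckerPow (pairTensor 2) N)
      (kroneckerPow (rotate (matMulTensor ℂ 2 2 2)) N) :=
    ((pairTensor_restrictsTo_coupling₁.kroneckerPow N).algDegeneratesTo_trans h).trans_restrictsTo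
      (matMul_restrictsTo_rotate_matMul.kroneckerPow N)
  exact pairTensor_pow_not_algDegeneratesTo_rotate_matMul_pow 2 N le_rfl hN h₁

/-- **`C₁^{⊠N}` is not a degeneration of `⟨2,2,2⟩^{⊠N}`** (`N ≥ 1`): Kernel IV through the
bridge and `rotate ⟨2,2,2⟩ ≥ ⟨2,2,2⟩`. [cite: Blaser2013, Lemma 5.5, Thm. 6.3] -/
theorem matMul_pow_not_algDegeneratesTo_coupling₁_pow (N : ℕ) (hN : 1 ≤ N) :
    ¬ AlgDegeneratesTo (kroneckerPow (matMulTensor ℂ 2 2 2) N) (kroneckerPow coupling₁ N) := by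
  intro h
  have h₁ : AlgDegeneratesTo (kroneckerPow (rotate (matMulTensor ℂ 2 2 2)) N)
      (kroneckerPow (pairTensor 2) N) :=
    ((tensorRestrictsTo_rotate_matMulTensor ℂ 2 2 2).kroneckerPow N).algDegeneratesTo_trans
      (h.trans_restrictsTo (coupling₁_restrictsTo_pairTensor.kroneckerPow N))
  exact rotate_matMul_pow_not_algDegeneratesTo_pairTensor_pow 2 N le_rfl hN h₁

/-- **`{C₁^{⊠N}, ⟨2,2,2⟩^{⊠N}}` is a degeneration antichain for every `N ≥ 1`** (items 27147 /
27150 of `Theses/OutsiderSandwich.lean`, census I52 / I64): one copy of lens-4's coupled block and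
one `2 × 2` matrix product are incomparable under degeneration in every Kronecker power, over `ℂ`.
[cite: Blaser2013, Thm. 6.3] -/
theorem coupling₁_pow_incomparable (N : ℕ) (hN : 1 ≤ N) :
    ¬ AlgDegeneratesTo (kroneckerPow coupling₁ N) (kroneckerPow (matMulTensor ℂ 2 2 2) N) ∧
      ¬ AlgDegeneratesTo (kroneckerPow (matMulTensor ℂ 2 2 2) N) (kroneckerPow coupling₁ N) :=
  ⟨coupling₁_pow_not_algDegeneratesTo_matMul_pow N hN, matMul_pow_not_algDegeneratesTo_coupling₁_pow N hN⟩

/-- Single copies: `C₁ ⋭ ⟨2,2,2⟩` and `⟨2,2,2⟩ ⋭ C₁` under degeneration (a fortiori restriction).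
[cite: BurgisserClausenShokrollahi1997, (15.19)] -/
theorem coupling₁_incomparable :
    ¬ AlgDegeneratesTo coupling₁ (matMulTensor ℂ 2 2 2) ∧
      ¬ AlgDegeneratesTo (matMulTensor ℂ 2 2 2) coupling₁ :=
  ⟨fun h => coupling₁_pow_not_algDegeneratesTo_matMul_pow 1 le_rfl (h.kroneckerPow 1),
    fun h => matMul_pow_not_algDegeneratesTo_coupling₁_pow 1 le_rfl (h.kroneckerPow 1)⟩

end Summit.MatrixMultiplication.MatrixMultiplication.Theorems.FarEdgeDescentCouplingBridge

end
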